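import Summits.BirchSwinnertonDyer.Rank1Residual.X11a.PrintDischargeKimDeep
import Summits.BirchSwinnertonDyer.BirchSwinnertonDyer.Theorems.PrintX11aLowerHalfMuTransportRecord285660u1
import Summits.BirchSwinnertonDyer.Rank1Residual.X11b.ChaPairs1
import Summits.BirchSwinnertonDyer.Rank1Residual.Supersingular.IntModelMinimalityKrausTwoMore
import Summits.BirchSwinnertonDyer.Rank1Residual.X11b.CertificateCheckBridge
import HarnessLib

/-!
# Class X11a, surjective leaf, Tamagawa-defect pairs: per-pair DEEP Kurihara-number records (Kim 2026
# Thm. 1.8 (6) beyond the unit case) — `285660u1 @ 5`, `285660u2 @ 5` (cell `bsd-print-x11a`, seat p1 g3;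
# `--supports` item stmt-BirchSwinnertonDyer-19064, helper; a SECOND, independent road for the pairs of
# road p2's μ-partner record `PrintX11aLowerHalfMuTransportRecord285660u1.lean`, whose kernel facts
# `isElliptic_c285660u{1,2}` / `isGloballyMinimal_c285660u{1,2}` are REUSED here)

HONEST FRAMING (cells `b2b-bsdres` / `bsd-print-x11a`, verbatim): the goal is to DELETE the
COMBINATION-SHAPED residual classes of the Birch–Swinnerton-Dyer formula for ALL analytic-rank
`≤ 1` elliptic curves over `ℚ` — "full BSD formula for every rank `≤ 1` curve in class `C`"
assembled STRICTLY from published theorems — so that the rank-`≤ 1` remainder becomes exactly the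
CONSTRUCTION-SHAPED classes, which are TYPED (missing-input `Prop`s), NOT attempted. This is not
"finishing BSD". PER PAIR: theorems only, no definition, no named fact; nothing is booked by this
file and no class label changes (referee / planner; two engines + REF per cell rules). The
CLASS-level lower half (crux `PrintX11a.X11aLowerHalf` = item stmt-BirchSwinnertonDyer-19064) stays OPEN.

## What

Sibling of `X11a/KimDeepRecords1.lean` (375440db1): the door `ClassX11a.missingLowerBoundAt_of_kimDeep`
/ `.bsdp_of_kimDeep` (`X11a/PrintDischargeKimDeep.lean`, p548893; Kim, Amer. J. Math. 148 (2026)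
Thm. 1.8 (6) BEYOND THE UNIT CASE in its LITERAL form
`Kim2026.rankZero_le_padicValNat_sha_of_kuriharaNumber_ne_zero` — these two curves are SPLIT
multiplicative at `5` with `5 ∣ v₅(Δ_min)` (`c₅ = 5`, `15`), so the `(t0)` twin is not automatic;
the literal fact carries the registry flag `K26-(6)-shallow@t>0`, whose exposure is depth `k ≤ t`,
and here `k = 2 ≥ 1 + t` since `t = ord₅ #E(ℚ₅)[5^∞] ≤ ord₅ v₅(Δ_min) = 1`) at the pairs
`285660u1 @ 5` and `285660u2 @ 5` (one isogeny class; both are surjective leaf pairs of X11a open per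
pair in the route text, with TAMAGAWA DEFECT `∏ c_ℓ = 30`), fed by the level-`2` certificate of kit job
j285778 (engine `kur2` of `KimDeepRecords1.lean`, same validations):

  `n = 902651 = 401 · 2251`, `ℓ ∈ 𝒫₂` (`401 ≡ 1 (25)`, `a₄₀₁ = 27 ≡ 402 (mod 125)`; `2251 ≡ 1 (125)`,
  `a₂₂₅₁ = 52 ≡ 2252 (mod 25)`), `Ẽ(𝔽₄₀₁) ≅ ℤ/375`, `Ẽ(𝔽₂₂₅₁) ≅ ℤ/1100 × ℤ/2` (`5`-part cyclic),
  least primitive roots `η₄₀₁ = 3`, `η₂₂₅₁ = 7` (Kim's convention), common denominator `D = 2`,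
  `450000` symbols, table sha256 `e20c00664c32171b…` (identical for u1 and u2), and
  **`δ̃_n ≡ 5 (mod 25)`** for both curves — `≡ 0 (mod 5)`, `≢ 0 (mod 25)`: `ord₅ δ̃_n = 1 = ∂^{(∞)}`.

KERNEL: elliptic and globally minimal REUSED from road p2's record (`MuTransport.isElliptic_c285660u{1,2}`,
`MuTransport.isGloballyMinimal_c285660u{1,2}`), `5 ∣ Δ ∧ 5 ∤ c₄` (multiplicative at `5`), `E[5]` irreducible by the
Frobenius witness `#Ẽ(𝔽₇) = 4` (`a₇ = 4`), `ord₅ ∏ c_ℓ ≥ 1` from the displayed `∏ c_ℓ = 30`.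
DISPLAYED (Cremona + the certificate; exactly the door's binders): `r_an = 0`, `¬ Ram W 5` (no
other multiplicative prime: `2, 3, 23` are additive), `ρ̄_{E,5}` onto (Cremona galrep: only `3` is
non-surjective, a `3`-isogeny), `∏ c_ℓ = 30`, a modular parametrisation datum `D` with `5 ∤ c_D`
(u1 is `X₀(N)`-optimal, `25 ∤ N = 2²·3³·5·23²`: Mazur Cor. 4.1; u2 through the `3`-isogeny),
`n = 902651 ∈ 𝒩₂` with cyclic reductions, `ψ ↠ ℤ/25`, and the certificate
`kuriharaNumber D.f 25 902651 ψ ≠ 0`. Evidence: job outputs `compute/j285778/outputs/`, seat folder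
`kit/RESULTS-285660u.md`, HOME/P1-ROAD.md §8, HOME/STATUS.md.

References: [Kim2022StructureSelmer] Thm. 1.9 (6) (= journal Thm. 1.8 (6)), §1.5.1, Prop. 3.2, Thm. 3.13;
[Mazur1978] Prop. 6.3 (1), Cor. 4.1; [Wuthrich2014] Prop. 21; [Miller2011LMS] Def. 1.1;
[SilvermanAEC2009] VII.1 Rem. 1.1, VII.5.1; [Kraus1989]; [Cremona2006] (labels 285660u1, 285660u2).
-/

set_option linter.dupNamespace false -- the directory name repeats the summit name (sibling precedent)

set_option autoImplicit false

noncomputable section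

open scoped Classical

open WeierstrassCurve Literature.NumberTheory.EllipticCurves
  Literature.NumberTheory.EllipticCurves.ModularForms
  Literature.NumberTheory.EllipticCurves.Rank1Residual
  Literature.NumberTheory.EllipticCurves.Rank1Residual.Typed
  Literature.NumberTheory.EllipticCurves.Rank1Residual.X11RankOneCertificates
  Literature.NumberTheory.EllipticCurves.Wuthrich2014
  NumberField IsDedekindDomain Rat.HeightOneSpectrum
  Summit.BirchSwinnertonDyer.BirchSwinnertonDyer.Rank1Residual.IntModel
  Summit.BirchSwinnertonDyer.BirchSwinnertonDyer.Rank1Residual.X11RankOne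
  Summit.BirchSwinnertonDyer.Rank1Residual.Supersingular

namespace Summit.BirchSwinnertonDyer.BirchSwinnertonDyer.Theorems.KimDeep

open Summit.BirchSwinnertonDyer.Rank1Residual

/-! ### `285660u1 @ 5` (`N = 285660 = 2²·3³·5·23²`, `ρ̄_{E,5}` onto, SPLIT multiplicative at `5`,
`∏ c_ℓ = 30`, `#E(ℚ)_tors = 1`, `#Ш_an = 25`) -/

/-- `#Ẽ(𝔽₇) = 4` for `285660u1` (`a₇ = 4`; `X² − a₇X + 7` root-free mod `5`: the Frobenius
irreducibility witness, kernel count `countPoints`). [folklore] -/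
theorem card_c285660u1_7 :
    Nat.card (((⟨0, 0, 0, -16938719127, -848533442942354⟩ : WeierstrassCurve ℤ).map
      (Int.castRingHom (ZMod 7))).toAffine.Point) = 4 := by
  have h := X11b.natCard_point_eq_countPoints 0 0 0 (-16938719127) (-848533442942354) 7 (by norm_num)
    (by decide +kernel)
  have h' : countPoints [0, 0, 0, -16938719127, -848533442942354] 7 = 4 := by decide +kernel
  exact_mod_cast h.trans h'

/-- **`285660u1 @ 5`: the LOWER half `ord₅ #Ш_an ≤ ord₅ #Ш`** (`Typed.MissingLowerBoundAt W 5`, crux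
19064's currency at the pair) from the DEEP Kurihara certificate of kit job j285778
(`δ̃_{401·2251} ≡ 5 (mod 25)`, level `k = 2 ≤ ord₅ ∏ c_ℓ + 1`) through
`ClassX11a.missingLowerBoundAt_of_kimDeep` (Kim 2026 Thm. 1.8 (6) beyond the unit case, LITERAL fact
`hKim` — flag `K26-(6)-shallow@t>0`, not exposed at depth `k = 2 ≥ 1 + t`; period transfer `hϖ`;
GZK; modularity `hmod`). KERNEL (instances from road p2's `MuTransport.isElliptic_c285660u1`,
`MuTransport.isGloballyMinimal_c285660u1`):
multiplicative at `5`, `E[5]` irreducible (`card_c285660u1_7`), `ord₅ ∏ c_ℓ ≥ 1` from `htam`. DISPLAYED: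
`r_an = 0`, `¬ Ram`, `ρ̄` onto, `∏ c_ℓ = 30`, datum `D` with `5 ∤ c_D`, `n = 902651 ∈ 𝒩₂` with cyclic
reductions, `ψ ↠ ℤ/25`, the certificate. PER PAIR; nothing booked.
[cite: Kim2022StructureSelmer, Thm. 1.9 (6) (PDF p. 8) and §1.5.1] [cite: Mazur1978, §6 Prop. 6.3 (1) and Cor. 4.1]
[cite: Miller2011LMS, Def. 1.1] [cite: Cremona2006, Table 1 (Cremona label 285660u1)] -/
theorem mlb5_c285660u1
    (hKim : Kim2026.rankZero_le_padicValNat_sha_of_kuriharaNumber_ne_zero)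
    (hϖ : realPeriodRat_eq_unit_mul_plusPeriod_of_multiplicative)
    (hGZK : rank_eq_analyticRank_of_analyticRank_le_one) (hmod : hasEntireLFunction_rat)
    (W : WeierstrassCurve ℚ) [W.IsElliptic] [W.IsGloballyMinimal]
    (hW : W = ⟨0, 0, 0, -16938719127, -848533442942354⟩) (hr : W.analyticRank = 0)
    (hnram : ¬ Ram W 5) (hsurj : Surj W 5) (htam : W.tamagawaProduct = 30)
    {N : ℕ} [NeZero N] (D : ModularParametrizationData W N) (hc : ¬ (5 : ℤ) ∣ D.maninConstant)
    (hn : Kato.IsKolyvaginProduct W 5 2 902651)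
    (hcyc : ∀ (ℓ : ℕ) [Fact ℓ.Prime], ℓ ∣ 902651 →
      Nat.card {P : ((WeierstrassCurve.integralModelInt W).map
          (Int.castRingHom (ZMod ℓ))).toAffine.Point // 5 • P = 0} ≤ 5)
    (ψ : (ℓ : ℕ) → (ZMod ℓ)ˣ →* Multiplicative (ZMod (5 ^ 2)))
    (hψ : ∀ ℓ ∈ (902651 : ℕ).primeFactors, Function.Surjective (ψ ℓ))
    (hδ : kuriharaNumber D.f (5 ^ 2) 902651 ψ ≠ 0) : MissingLowerBoundAt W 5 := by
  haveI : Fact (Nat.Prime 5) := ⟨by norm_num⟩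
  haveI : Fact (Nat.Prime 7) := ⟨by norm_num⟩
  haveI : NeZero (902651 : ℕ) := ⟨by norm_num⟩
  have hI' : integralModelInt W = ⟨0, 0, 0, -16938719127, -848533442942354⟩ := by
    subst hW; exact integralModelInt_eq_of_map_eq _ (map_mk_int 0 0 0 (-16938719127) (-848533442942354))
  have hmult : Mult W 5 :=
    hasMultiplicativeReductionAtPrime_of_intModel hI' 5 (by decide +kernel) (by decide +kernel)
  have hirr : Irr W 5 :=
    hasIrreducibleModPGaloisRep_of_intModel_of_noroot (hp := ⟨by norm_num⟩) (hℓ := ⟨by norm_num⟩)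
      hI' 5 7 (by norm_num) (by decide +kernel) card_c285660u1_7 (by decide)
  have hX : ClassX11a W 5 := ⟨hr, by norm_num, hmult, hirr, hnram⟩
  have hkc : 2 ≤ padicValNat 5 W.tamagawaProduct + 1 := by
    have h1 : 1 ≤ padicValNat 5 W.tamagawaProduct := by
      rw [htam]; exact one_le_padicValNat_of_dvd (by norm_num) (by norm_num)
    omega
  exact hX.missingLowerBoundAt_of_kimDeep hKim hϖ hGZK hmod le_rfl hsurj D hc
    2 902651 (by norm_num) hkc hn hcyc ψ hψ hδ

/-- **`BSD(285660u1, 5)`** from the same certificate (lower half above + Wuthrich 2014 Prop. 21 `hWu` for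
the Euler half), through `ClassX11a.bsdp_of_kimDeep`. PER PAIR; nothing booked.
[cite: Wuthrich2014, Prop. 21 (p. 400)] [cite: Kim2022StructureSelmer, Thm. 1.9 (6) (PDF p. 8)]
[cite: Miller2011LMS, Def. 1.1] [cite: Cremona2006, Table 1 (Cremona label 285660u1)] -/
theorem bsdp5_c285660u1 (hWu : sha_dvd_analyticSha)
    (hKim : Kim2026.rankZero_le_padicValNat_sha_of_kuriharaNumber_ne_zero)
    (hϖ : realPeriodRat_eq_unit_mul_plusPeriod_of_multiplicative)
    (hGZK : rank_eq_analyticRank_of_analyticRank_le_one) (hmod : hasEntireLFunction_rat)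
    (W : WeierstrassCurve ℚ) [W.IsElliptic] [W.IsGloballyMinimal]
    (hW : W = ⟨0, 0, 0, -16938719127, -848533442942354⟩) (hr : W.analyticRank = 0)
    (hnram : ¬ Ram W 5) (hsurj : Surj W 5) (htam : W.tamagawaProduct = 30)
    {N : ℕ} [NeZero N] (D : ModularParametrizationData W N) (hc : ¬ (5 : ℤ) ∣ D.maninConstant)
    (hn : Kato.IsKolyvaginProduct W 5 2 902651)
    (hcyc : ∀ (ℓ : ℕ) [Fact ℓ.Prime], ℓ ∣ 902651 →
      Nat.card {P : ((WeierstrassCurve.integralModelInt W).map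
          (Int.castRingHom (ZMod ℓ))).toAffine.Point // 5 • P = 0} ≤ 5)
    (ψ : (ℓ : ℕ) → (ZMod ℓ)ˣ →* Multiplicative (ZMod (5 ^ 2)))
    (hψ : ∀ ℓ ∈ (902651 : ℕ).primeFactors, Function.Surjective (ψ ℓ))
    (hδ : kuriharaNumber D.f (5 ^ 2) 902651 ψ ≠ 0) : BSDp W 5 := by
  haveI : Fact (Nat.Prime 5) := ⟨by norm_num⟩
  haveI : Fact (Nat.Prime 7) := ⟨by norm_num⟩
  haveI : NeZero (902651 : ℕ) := ⟨by norm_num⟩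
  have hI' : integralModelInt W = ⟨0, 0, 0, -16938719127, -848533442942354⟩ := by
    subst hW; exact integralModelInt_eq_of_map_eq _ (map_mk_int 0 0 0 (-16938719127) (-848533442942354))
  have hmult : Mult W 5 :=
    hasMultiplicativeReductionAtPrime_of_intModel hI' 5 (by decide +kernel) (by decide +kernel)
  have hirr : Irr W 5 :=
    hasIrreducibleModPGaloisRep_of_intModel_of_noroot (hp := ⟨by norm_num⟩) (hℓ := ⟨by norm_num⟩)
      hI' 5 7 (by norm_num) (by decide +kernel) card_c285660u1_7 (by decide)
  have hX : ClassX11a W 5 := ⟨hr, by norm_num, hmult, hirr, hnram⟩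
  have hkc : 2 ≤ padicValNat 5 W.tamagawaProduct + 1 := by
    have h1 : 1 ≤ padicValNat 5 W.tamagawaProduct := by
      rw [htam]; exact one_le_padicValNat_of_dvd (by norm_num) (by norm_num)
    omega
  exact hX.bsdp_of_kimDeep hWu hKim hϖ hGZK hmod le_rfl hsurj D hc
    2 902651 (by norm_num) hkc hn hcyc ψ hψ hδ

/-! ### `285660u2 @ 5` (`N = 285660 = 2²·3³·5·23²`, `ρ̄_{E,5}` onto, SPLIT multiplicative at `5`,
`∏ c_ℓ = 30`, `#E(ℚ)_tors = 1`, `#Ш_an = 25`) -/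

/-- `#Ẽ(𝔽₇) = 4` for `285660u2` (`a₇ = 4`; `X² − a₇X + 7` root-free mod `5`: the Frobenius
irreducibility witness, kernel count `countPoints`). [folklore] -/
theorem card_c285660u2_7 :
    Nat.card (((⟨0, 0, 0, -16936624287, -848753813301066⟩ : WeierstrassCurve ℤ).map
      (Int.castRingHom (ZMod 7))).toAffine.Point) = 4 := by
  have h := X11b.natCard_point_eq_countPoints 0 0 0 (-16936624287) (-848753813301066) 7 (by norm_num)
    (by decide +kernel)
  have h' : countPoints [0, 0, 0, -16936624287, -848753813301066] 7 = 4 := by decide +kernel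
  exact_mod_cast h.trans h'

/-- **`285660u2 @ 5`: the LOWER half `ord₅ #Ш_an ≤ ord₅ #Ш`** (`Typed.MissingLowerBoundAt W 5`, crux
19064's currency at the pair) from the DEEP Kurihara certificate of kit job j285778
(`δ̃_{401·2251} ≡ 5 (mod 25)`, level `k = 2 ≤ ord₅ ∏ c_ℓ + 1`) through
`ClassX11a.missingLowerBoundAt_of_kimDeep` (Kim 2026 Thm. 1.8 (6) beyond the unit case, LITERAL fact
`hKim` — flag `K26-(6)-shallow@t>0`, not exposed at depth `k = 2 ≥ 1 + t`; period transfer `hϖ`;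
GZK; modularity `hmod`). KERNEL (instances from road p2's `MuTransport.isElliptic_c285660u2`,
`MuTransport.isGloballyMinimal_c285660u2`):
multiplicative at `5`, `E[5]` irreducible (`card_c285660u2_7`), `ord₅ ∏ c_ℓ ≥ 1` from `htam`. DISPLAYED:
`r_an = 0`, `¬ Ram`, `ρ̄` onto, `∏ c_ℓ = 30`, datum `D` with `5 ∤ c_D`, `n = 902651 ∈ 𝒩₂` with cyclic
reductions, `ψ ↠ ℤ/25`, the certificate. PER PAIR; nothing booked.
[cite: Kim2022StructureSelmer, Thm. 1.9 (6) (PDF p. 8) and §1.5.1] [cite: Mazur1978, §6 Prop. 6.3 (1) and Cor. 4.1]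
[cite: Miller2011LMS, Def. 1.1] [cite: Cremona2006, Table 1 (Cremona label 285660u2)] -/
theorem mlb5_c285660u2
    (hKim : Kim2026.rankZero_le_padicValNat_sha_of_kuriharaNumber_ne_zero)
    (hϖ : realPeriodRat_eq_unit_mul_plusPeriod_of_multiplicative)
    (hGZK : rank_eq_analyticRank_of_analyticRank_le_one) (hmod : hasEntireLFunction_rat)
    (W : WeierstrassCurve ℚ) [W.IsElliptic] [W.IsGloballyMinimal]
    (hW : W = ⟨0, 0, 0, -16936624287, -848753813301066⟩) (hr : W.analyticRank = 0)
    (hnram : ¬ Ram W 5) (hsurj : Surj W 5) (htam : W.tamagawaProduct = 30)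
    {N : ℕ} [NeZero N] (D : ModularParametrizationData W N) (hc : ¬ (5 : ℤ) ∣ D.maninConstant)
    (hn : Kato.IsKolyvaginProduct W 5 2 902651)
    (hcyc : ∀ (ℓ : ℕ) [Fact ℓ.Prime], ℓ ∣ 902651 →
      Nat.card {P : ((WeierstrassCurve.integralModelInt W).map
          (Int.castRingHom (ZMod ℓ))).toAffine.Point // 5 • P = 0} ≤ 5)
    (ψ : (ℓ : ℕ) → (ZMod ℓ)ˣ →* Multiplicative (ZMod (5 ^ 2)))
    (hψ : ∀ ℓ ∈ (902651 : ℕ).primeFactors, Function.Surjective (ψ ℓ))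
    (hδ : kuriharaNumber D.f (5 ^ 2) 902651 ψ ≠ 0) : MissingLowerBoundAt W 5 := by
  haveI : Fact (Nat.Prime 5) := ⟨by norm_num⟩
  haveI : Fact (Nat.Prime 7) := ⟨by norm_num⟩
  haveI : NeZero (902651 : ℕ) := ⟨by norm_num⟩
  have hI' : integralModelInt W = ⟨0, 0, 0, -16936624287, -848753813301066⟩ := by
    subst hW; exact integralModelInt_eq_of_map_eq _ (map_mk_int 0 0 0 (-16936624287) (-848753813301066))
  have hmult : Mult W 5 :=
    hasMultiplicativeReductionAtPrime_of_intModel hI' 5 (by decide +kernel) (by decide +kernel)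
  have hirr : Irr W 5 :=
    hasIrreducibleModPGaloisRep_of_intModel_of_noroot (hp := ⟨by norm_num⟩) (hℓ := ⟨by norm_num⟩)
      hI' 5 7 (by norm_num) (by decide +kernel) card_c285660u2_7 (by decide)
  have hX : ClassX11a W 5 := ⟨hr, by norm_num, hmult, hirr, hnram⟩
  have hkc : 2 ≤ padicValNat 5 W.tamagawaProduct + 1 := by
    have h1 : 1 ≤ padicValNat 5 W.tamagawaProduct := by
      rw [htam]; exact one_le_padicValNat_of_dvd (by norm_num) (by norm_num)
    omega
  exact hX.missingLowerBoundAt_of_kimDeep hKim hϖ hGZK hmod le_rfl hsurj D hc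
    2 902651 (by norm_num) hkc hn hcyc ψ hψ hδ

/-- **`BSD(285660u2, 5)`** from the same certificate (lower half above + Wuthrich 2014 Prop. 21 `hWu` for
the Euler half), through `ClassX11a.bsdp_of_kimDeep`. PER PAIR; nothing booked.
[cite: Wuthrich2014, Prop. 21 (p. 400)] [cite: Kim2022StructureSelmer, Thm. 1.9 (6) (PDF p. 8)]
[cite: Miller2011LMS, Def. 1.1] [cite: Cremona2006, Table 1 (Cremona label 285660u2)] -/
theorem bsdp5_c285660u2 (hWu : sha_dvd_analyticSha)
    (hKim : Kim2026.rankZero_le_padicValNat_sha_of_kuriharaNumber_ne_zero)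
    (hϖ : realPeriodRat_eq_unit_mul_plusPeriod_of_multiplicative)
    (hGZK : rank_eq_analyticRank_of_analyticRank_le_one) (hmod : hasEntireLFunction_rat)
    (W : WeierstrassCurve ℚ) [W.IsElliptic] [W.IsGloballyMinimal]
    (hW : W = ⟨0, 0, 0, -16936624287, -848753813301066⟩) (hr : W.analyticRank = 0)
    (hnram : ¬ Ram W 5) (hsurj : Surj W 5) (htam : W.tamagawaProduct = 30)
    {N : ℕ} [NeZero N] (D : ModularParametrizationData W N) (hc : ¬ (5 : ℤ) ∣ D.maninConstant)
    (hn : Kato.IsKolyvaginProduct W 5 2 902651)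
    (hcyc : ∀ (ℓ : ℕ) [Fact ℓ.Prime], ℓ ∣ 902651 →
      Nat.card {P : ((WeierstrassCurve.integralModelInt W).map
          (Int.castRingHom (ZMod ℓ))).toAffine.Point // 5 • P = 0} ≤ 5)
    (ψ : (ℓ : ℕ) → (ZMod ℓ)ˣ →* Multiplicative (ZMod (5 ^ 2)))
    (hψ : ∀ ℓ ∈ (902651 : ℕ).primeFactors, Function.Surjective (ψ ℓ))
    (hδ : kuriharaNumber D.f (5 ^ 2) 902651 ψ ≠ 0) : BSDp W 5 := by
  haveI : Fact (Nat.Prime 5) := ⟨by norm_num⟩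
  haveI : Fact (Nat.Prime 7) := ⟨by norm_num⟩
  haveI : NeZero (902651 : ℕ) := ⟨by norm_num⟩
  have hI' : integralModelInt W = ⟨0, 0, 0, -16936624287, -848753813301066⟩ := by
    subst hW; exact integralModelInt_eq_of_map_eq _ (map_mk_int 0 0 0 (-16936624287) (-848753813301066))
  have hmult : Mult W 5 :=
    hasMultiplicativeReductionAtPrime_of_intModel hI' 5 (by decide +kernel) (by decide +kernel)
  have hirr : Irr W 5 :=
    hasIrreducibleModPGaloisRep_of_intModel_of_noroot (hp := ⟨by norm_num⟩) (hℓ := ⟨by norm_num⟩)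
      hI' 5 7 (by norm_num) (by decide +kernel) card_c285660u2_7 (by decide)
  have hX : ClassX11a W 5 := ⟨hr, by norm_num, hmult, hirr, hnram⟩
  have hkc : 2 ≤ padicValNat 5 W.tamagawaProduct + 1 := by
    have h1 : 1 ≤ padicValNat 5 W.tamagawaProduct := by
      rw [htam]; exact one_le_padicValNat_of_dvd (by norm_num) (by norm_num)
    omega
  exact hX.bsdp_of_kimDeep hWu hKim hϖ hGZK hmod le_rfl hsurj D hc
    2 902651 (by norm_num) hkc hn hcyc ψ hψ hδ

end Summit.BirchSwinnertonDyer.BirchSwinnertonDyer.Theorems.KimDeep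

end
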